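import Mathlib.Tactic
import HarnessLib

/-!
# The explicit nonnesting matchings of the time-cut fooling set (support for `TimeCutFoolingSet`)

Helper toward route item `stmt-ValiantsHypothesis-11621` (`Theses.FifoMatching.TimeCutFoolingSet`):
the partner function, on `ℕ`, of the explicit family of nest-free (FIFO) perfect matchings `M_b` of
`[0, 2n)` indexed by bit vectors `b` (here an arbitrary `bb : ℕ → ℕ` with values `≤ 1`), for
parameters `n = 2j + k`, `k ≤ j`:

* short pairs `2t ↔ 2t + 1` on `[0, 2j)`;
* crossing arcs `2j + i ↔ n + 2i + b_i` for `i < k` (opened before the cut `n`, closed after it);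
* second-half arcs `n + 2i + (1 - b_i) ↔ n + 2k + i` for `i < k`;
* tail short pairs on `[n + 3k, 2n)` (note `n + 3k = 2j + 4k` is even).

We prove that `pm` is a fixed-point-free involution of `[0, 2n)` (`pm_lt`, `pm_ne`, `pm_pm`) whose
closer is a strictly increasing function of the opener (`pm_mono`), hence nonnesting in the form used
by the route (`pm_nonnest`). The bit `b_i` is read off the matching twice: `n + 2i + b_i` closes an
arc opened before the cut, while `n + 2i + (1 - b_i)` opens an arc after the cut — this is the fooling
property used in `FifoMatchingTimeCutFoolingSet`. [folklore; Nisan 1991-style fooling set]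
-/

-- layout Summits/ValiantsHypothesis/ValiantsHypothesis forces the duplicated namespace component
set_option linter.dupNamespace false

namespace Summit.ValiantsHypothesis.ValiantsHypothesis.Theorems.FifoMatching

namespace TimeCut

/-- The partner function of the matching `M_b` on `[0, 2n)` (`n = 2j + k`), with the bit vector
given as `bb : ℕ → ℕ` (values `≤ 1`). [folklore] -/
def pm (j k n : ℕ) (bb : ℕ → ℕ) (p : ℕ) : ℕ :=
  if p < 2 * j ∨ n + 3 * k ≤ p then (if p % 2 = 0 then p + 1 else p - 1)
  else if p < n then n + 2 * (p - 2 * j) + bb (p - 2 * j)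
  else if p < n + 2 * k then
    (if (p - n) % 2 = bb ((p - n) / 2) then 2 * j + (p - n) / 2 else n + 2 * k + (p - n) / 2)
  else n + 2 * (p - n - 2 * k) + (1 - bb (p - n - 2 * k))

variable {j k n : ℕ} {bb : ℕ → ℕ}

/-- Head short pair, even end. [folklore] -/
theorem pm_S0 {t : ℕ} (ht : t < j) : pm j k n bb (2 * t) = 2 * t + 1 := by
  unfold pm
  rw [if_pos (Or.inl (by omega)), if_pos (by omega)]

/-- Head short pair, odd end. [folklore] -/
theorem pm_S1 {t : ℕ} (ht : t < j) : pm j k n bb (2 * t + 1) = 2 * t := by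
  unfold pm
  rw [if_pos (Or.inl (by omega)), if_neg (by omega)]
  omega

/-- Crossing arc, opener side: `2j + i ↦ n + 2i + b_i`. [folklore] -/
theorem pm_C (h1 : n = 2 * j + k) {i : ℕ} (hi : i < k) :
    pm j k n bb (2 * j + i) = n + 2 * i + bb i := by
  unfold pm
  rw [if_neg (by omega), if_pos (by omega), Nat.add_sub_cancel_left]

/-- Crossing arc, closer side: `n + 2i + b_i ↦ 2j + i`. [folklore] -/
theorem pm_Ccl (h1 : n = 2 * j + k) (hb : ∀ i, bb i ≤ 1) {i : ℕ} (hi : i < k) :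
    pm j k n bb (n + 2 * i + bb i) = 2 * j + i := by
  have hbi := hb i
  have e1 : (n + 2 * i + bb i - n) / 2 = i := by omega
  have e2 : (n + 2 * i + bb i - n) % 2 = bb i := by omega
  unfold pm
  rw [e1, e2]
  split_ifs <;> omega

/-- Second-half arc, opener side: `n + 2i + (1 - b_i) ↦ n + 2k + i`. [folklore] -/
theorem pm_Rop (h1 : n = 2 * j + k) (hb : ∀ i, bb i ≤ 1) {i : ℕ} (hi : i < k) :
    pm j k n bb (n + 2 * i + (1 - bb i)) = n + 2 * k + i := by
  have hbi := hb i
  have e1 : (n + 2 * i + (1 - bb i) - n) / 2 = i := by omega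
  have e2 : (n + 2 * i + (1 - bb i) - n) % 2 = 1 - bb i := by omega
  unfold pm
  rw [e1, e2]
  split_ifs <;> omega

/-- Second-half arc, closer side: `n + 2k + i ↦ n + 2i + (1 - b_i)`. [folklore] -/
theorem pm_Rcl (h1 : n = 2 * j + k) {i : ℕ} (hi : i < k) :
    pm j k n bb (n + 2 * k + i) = n + 2 * i + (1 - bb i) := by
  have e1 : n + 2 * k + i - n - 2 * k = i := by omega
  unfold pm
  rw [if_neg (by omega), if_neg (by omega), if_neg (by omega), e1]

/-- Tail short pair, even end (`n + 3k` is even). [folklore] -/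
theorem pm_T0 (h1 : n = 2 * j + k) (t : ℕ) :
    pm j k n bb (n + 3 * k + 2 * t) = n + 3 * k + 2 * t + 1 := by
  unfold pm
  rw [if_pos (Or.inr (by omega)), if_pos (by omega)]

/-- Tail short pair, odd end. [folklore] -/
theorem pm_T1 (h1 : n = 2 * j + k) (t : ℕ) :
    pm j k n bb (n + 3 * k + 2 * t + 1) = n + 3 * k + 2 * t := by
  unfold pm
  rw [if_pos (Or.inr (by omega)), if_neg (by omega)]
  omega

/-- Every position of `[0, 2n)` is an endpoint of one of the four kinds of arcs. [folklore] -/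
theorem classify (h1 : n = 2 * j + k) (hb : ∀ i, bb i ≤ 1) {p : ℕ} (hp : p < 2 * n) :
    (∃ t, t < j ∧ (p = 2 * t ∨ p = 2 * t + 1)) ∨
    (∃ i, i < k ∧ p = 2 * j + i) ∨
    (∃ i, i < k ∧ (p = n + 2 * i + bb i ∨ p = n + 2 * i + (1 - bb i))) ∨
    (∃ i, i < k ∧ p = n + 2 * k + i) ∨
    (∃ t, t < j - k ∧ (p = n + 3 * k + 2 * t ∨ p = n + 3 * k + 2 * t + 1)) := by
  by_cases hA : p < 2 * j
  · exact Or.inl ⟨p / 2, by omega, by omega⟩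
  by_cases hB : p < n
  · exact Or.inr (Or.inl ⟨p - 2 * j, by omega, by omega⟩)
  by_cases hC : p < n + 2 * k
  · have := hb ((p - n) / 2)
    exact Or.inr (Or.inr (Or.inl ⟨(p - n) / 2, by omega, by omega⟩))
  by_cases hD : p < n + 3 * k
  · exact Or.inr (Or.inr (Or.inr (Or.inl ⟨p - n - 2 * k, by omega, by omega⟩)))
  · exact Or.inr (Or.inr (Or.inr (Or.inr ⟨(p - n - 3 * k) / 2, by omega, by omega⟩)))

/-- `pm` maps `[0, 2n)` to itself. [folklore] -/
theorem pm_lt (h1 : n = 2 * j + k) (h2 : k ≤ j) (hb : ∀ i, bb i ≤ 1) {p : ℕ} (hp : p < 2 * n) :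
    pm j k n bb p < 2 * n := by
  have := hb (p - 2 * j)
  have := hb (p - n - 2 * k)
  unfold pm
  split_ifs <;> omega

/-- `pm` has no fixed point. [folklore] -/
theorem pm_ne (h1 : n = 2 * j + k) {p : ℕ} : pm j k n bb p ≠ p := by
  unfold pm
  split_ifs <;> omega

/-- `pm` is an involution on `[0, 2n)`. [folklore] -/
theorem pm_pm (h1 : n = 2 * j + k) (hb : ∀ i, bb i ≤ 1) {p : ℕ} (hp : p < 2 * n) :
    pm j k n bb (pm j k n bb p) = p := by
  rcases classify h1 hb hp with ⟨t, ht, rfl | rfl⟩ | ⟨i, hi, rfl⟩ | ⟨i, hi, rfl | rfl⟩ |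
      ⟨i, hi, rfl⟩ | ⟨t, ht, rfl | rfl⟩
  · rw [pm_S0 ht, pm_S1 ht]
  · rw [pm_S1 ht, pm_S0 ht]
  · rw [pm_C h1 hi, pm_Ccl h1 hb hi]
  · rw [pm_Ccl h1 hb hi, pm_C h1 hi]
  · rw [pm_Rop h1 hb hi, pm_Rcl h1 hi]
  · rw [pm_Rcl h1 hi, pm_Rop h1 hb hi]
  · rw [pm_T0 h1 t, pm_T1 h1 t]
  · rw [pm_T1 h1 t, pm_T0 h1 t]

/-- The openers (`p < pm p`) are: even head positions, `[2j, n)`, the positions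
`n + 2i + (1 - b_i)`, and even tail positions. [folklore] -/
theorem opener_classify (h1 : n = 2 * j + k) (hb : ∀ i, bb i ≤ 1) {p : ℕ} (hp : p < 2 * n)
    (ho : p < pm j k n bb p) :
    (∃ t, t < j ∧ p = 2 * t) ∨ (∃ i, i < k ∧ p = 2 * j + i) ∨
    (∃ i, i < k ∧ p = n + 2 * i + (1 - bb i)) ∨ (∃ t, t < j - k ∧ p = n + 3 * k + 2 * t) := by
  rcases classify h1 hb hp with ⟨t, ht, rfl | rfl⟩ | ⟨i, hi, rfl⟩ | ⟨i, hi, rfl | rfl⟩ |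
      ⟨i, hi, rfl⟩ | ⟨t, ht, rfl | rfl⟩
  · exact Or.inl ⟨t, ht, rfl⟩
  · rw [pm_S1 ht] at ho; omega
  · exact Or.inr (Or.inl ⟨i, hi, rfl⟩)
  · have := hb i; rw [pm_Ccl h1 hb hi] at ho; omega
  · exact Or.inr (Or.inr (Or.inl ⟨i, hi, rfl⟩))
  · have := hb i; rw [pm_Rcl h1 hi] at ho; omega
  · exact Or.inr (Or.inr (Or.inr ⟨t, ht, rfl⟩))
  · rw [pm_T1 h1 t] at ho; omega

/-- **The closer is a strictly increasing function of the opener.** [folklore] -/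
theorem pm_mono (h1 : n = 2 * j + k) (hb : ∀ i, bb i ≤ 1) {p q : ℕ} (hp : p < 2 * n)
    (hq : q < 2 * n) (hpq : p < q) (hpo : p < pm j k n bb p) (hqo : q < pm j k n bb q) :
    pm j k n bb p < pm j k n bb q := by
  rcases opener_classify h1 hb hp hpo with ⟨t, ht, rfl⟩ | ⟨i, hi, rfl⟩ | ⟨i, hi, rfl⟩ | ⟨t, ht, rfl⟩
  · -- `p` a head opener
    rw [pm_S0 ht]
    rcases opener_classify h1 hb hq hqo with
        ⟨t', ht', rfl⟩ | ⟨i', hi', rfl⟩ | ⟨i', hi', rfl⟩ | ⟨t', ht', rfl⟩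
    · rw [pm_S0 ht']; omega
    · rw [pm_C h1 hi']; omega
    · rw [pm_Rop h1 hb hi']; omega
    · rw [pm_T0 h1 t']; omega
  · -- `p` a crossing opener
    have := hb i
    rw [pm_C h1 hi]
    rcases opener_classify h1 hb hq hqo with
        ⟨t', ht', rfl⟩ | ⟨i', hi', rfl⟩ | ⟨i', hi', rfl⟩ | ⟨t', ht', rfl⟩
    · omega
    · have := hb i'; rw [pm_C h1 hi']; omega
    · rw [pm_Rop h1 hb hi']; omega
    · rw [pm_T0 h1 t']; omega
  · -- `p` a second-half opener
    have := hb i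
    rw [pm_Rop h1 hb hi]
    rcases opener_classify h1 hb hq hqo with
        ⟨t', ht', rfl⟩ | ⟨i', hi', rfl⟩ | ⟨i', hi', rfl⟩ | ⟨t', ht', rfl⟩
    · omega
    · omega
    · have := hb i'
      rw [pm_Rop h1 hb hi']
      rcases Nat.lt_trichotomy i i' with h | rfl | h <;> omega
    · rw [pm_T0 h1 t']; omega
  · -- `p` a tail opener
    rw [pm_T0 h1 t]
    rcases opener_classify h1 hb hq hqo with
        ⟨t', ht', rfl⟩ | ⟨i', hi', rfl⟩ | ⟨i', hi', rfl⟩ | ⟨t', ht', rfl⟩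
    · omega
    · omega
    · have := hb i'; omega
    · rw [pm_T0 h1 t']; omega

/-- **Nonnesting** in the route's form: no `p < q < pm q < pm p`. [folklore] -/
theorem pm_nonnest (h1 : n = 2 * j + k) (hb : ∀ i, bb i ≤ 1) {p q : ℕ}
    (hp : p < 2 * n) (hq : q < 2 * n) (hpq : p < q) (hqo : q < pm j k n bb q)
    (hcl : pm j k n bb q < pm j k n bb p) : False := by
  rcases Nat.lt_or_ge p (pm j k n bb p) with hpo | hpc
  · exact absurd (pm_mono h1 hb hp hq hpq hpo hqo) (by omega)
  · omega

end TimeCut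

end Summit.ValiantsHypothesis.ValiantsHypothesis.Theorems.FifoMatching
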